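import Literature.MathematicalPhysics.QuantumLattice.XYOrderInfrared
import Literature.MathematicalPhysics.QuantumLattice.XYOrderDischarges
import Literature.MathematicalPhysics.QuantumLattice.XYOrderIntegralProofs
import Mathlib.Algebra.QuadraticDiscriminant
import HarnessLib

/-!
# Kennedy–Lieb–Shastry, XY model: Gaussian domination ⇒ the infrared bound (A) ⇒ long-range order

Trunk T-QLATTICE; sibling proof file of `XYOrderProofs.lean` / `XYOrderInfrared.lean` (item
`provefact-Literature.Hubbard.kennedy_lieb_shastry_xy_ground`). No statement is introduced or changed.
This file carries out, with complete proofs, the *direct ground-state derivation* of the infrared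
bound of Kennedy–Lieb–Shastry (J. Stat. Phys. 53 (1988) 1019–1030, pp. 1026–1027, eqs. (12)–(14),
(18)–(19)), in the XY setting of [KLS1988PRL] (after eq. (4): "It can also be derived directly in
the ground state, as done in the XXX context in Ref. 4"), from the single named fact
`kls_xy_gaussianDomination_ground` **(GD)** of `XYOrderInfrared.lean`:

* `Matrix.groundState_infraredBound_quadratic`, `Matrix.groundState_infraredBound` — the abstract
  linear algebra: if `E₀(H) ≤ E₀(H + tV + ½t²Q)` for all real `t` (`H`, `V` Hermitian), then
  `0 ≤ ½Q + 2μ ω(V²) + μ² ω(V(H-E₀)V)` for all real `μ` (second-order perturbation theory done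
  variationally with the trial projection `(1 + tμV)P₀`, for the tracial ground state `ω` of a
  possibly degenerate ground level), whence `ω(V²)² ≤ ½Q ω(V(H-E₀)V)` — the Cauchy–Schwarz step
  (12) and the susceptibility bound (14) of the source in one stroke;
* the Fourier analysis of the two Hermitian modes `C_q = Σ cos(q·x) S¹_x`, `D_q = Σ sin(q·x) S¹_x`:
  `V_{cos(q·)} = 2E_q C_q`, `V_{sin(q·)} = 2E_q D_q` (discrete Laplacian of a plane wave),
  `Q(cos(q·)) + Q(sin(q·)) = 2E_q |Λ|`, and `|Λ| ĝ¹_q = ω(C_q²) + ω(D_q²)`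
  (`xyStructureFactor_eq_modes`);
* the double commutator (13), XY version: for a wave `A = Σ a_x S¹_x`,
  `[A, [H, A]] = Σ_{⟨xy⟩} ((a_x² + a_y²) S²_x S²_y - 2a_x a_y S³_x S³_y)` (`lie_lie_xyTorus`), so that
  `ω([C,[H,C]]) + ω([D,[H,D]]) = 2 Σᵢ Σ_z (G²(z,z+eᵢ) - cos qᵢ G³(z,z+eᵢ))`;
* the lattice symmetry (SYM) `Σ_z G^α(z, z+eᵢ) = |Λ| e_α` for every direction `i` (axis
  permutations act by permutation unitaries commuting with `H`; the tracial ground state is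
  invariant);
* the assembly `xy_infraredBound_of_groundEnergy_le`: the two quadratic inequalities for `C_q`
  and `D_q` add up to one whose discriminant is `(|Λ|ĝ¹_q)² ≤ (|Λ|/4E_q) |Λ| Σᵢ (e₂ - e₃ cos qᵢ)`,
  and `e₂ = e₁` by (S); hence **(GD) ⇒ (A)** (`kls_xy_infraredBound_ground_of_gaussianDomination`)
  and, with (B), (C), (D), (S), (T) (`XYOrderDischarges`), (E), (R'') (`XYOrderIntegralProofs`),
  **(GD) ⇒ the theorem** (`kennedy_lieb_shastry_xy_ground_of_gaussianDomination`).

## References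

* [KLS1988PRL] T. Kennedy, E. H. Lieb, B. S. Shastry, *The XY model has long-range order for all
  spins and all dimensions greater than one*, Phys. Rev. Lett. 61 (1988) 2582–2584.
* [KLS1988JSP] T. Kennedy, E. H. Lieb, B. S. Shastry, *Existence of Néel order in some spin-½
  Heisenberg antiferromagnets*, J. Stat. Phys. 53 (1988) 1019–1030.
* [DLS1978] F. J. Dyson, E. H. Lieb, B. Simon, J. Stat. Phys. 18 (1978) 335–383.
-/

noncomputable section

open Matrix Finset Filter Topology
open scoped ComplexOrder
open Literature.MathematicalPhysics.QuantumLattice Literature.Probability.LatticeModels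

namespace Matrix

open Literature.MathematicalPhysics.QuantumLattice

variable {m : Type*} [Fintype m] [DecidableEq m]

/-- `(H - E₀) P₀ = 0`. [folklore] -/
theorem sub_groundEnergy_mul_groundProj (H : Matrix m m ℂ) :
    (H - (H.groundEnergy : ℂ) • (1 : Matrix m m ℂ)) * H.groundProj = 0 := by
  rw [sub_mul, mul_groundProj, Matrix.smul_mul, one_mul, sub_self]

/-- `P₀ (H - E₀) = 0` for Hermitian `H`. [folklore] -/
theorem groundProj_mul_sub_groundEnergy {H : Matrix m m ℂ} (hH : H.IsHermitian) :
    H.groundProj * (H - (H.groundEnergy : ℂ) • (1 : Matrix m m ℂ)) = 0 := by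
  rw [mul_sub, groundProj_mul hH, Matrix.mul_smul, mul_one, sub_self]

omit [Fintype m] [DecidableEq m] in
/-- A real multiple of a Hermitian matrix is Hermitian. [folklore] -/
theorem IsHermitian.ofReal_smul {A : Matrix m m ℂ} (hA : A.IsHermitian) (t : ℝ) :
    ((t : ℂ) • A).IsHermitian := by
  rw [IsHermitian, conjTranspose_smul, hA.eq, Complex.star_def, Complex.conj_ofReal]

/-- If `E₀(H) ≤ E₀(X)` then `X - E₀(H) ≥ 0`. [folklore] -/
theorem posSemidef_sub_of_groundEnergy_le {H X : Matrix m m ℂ} (hX : X.IsHermitian)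
    (h : H.groundEnergy ≤ X.groundEnergy) :
    (X - (H.groundEnergy : ℂ) • (1 : Matrix m m ℂ)).PosSemidef := by
  have h1 := posSemidef_sub_groundEnergy hX
  have h2 : (((X.groundEnergy - H.groundEnergy : ℝ) : ℂ) • (1 : Matrix m m ℂ)).PosSemidef :=
    PosSemidef.one.smul (Complex.zero_le_real.2 (sub_nonneg.2 h))
  have h3 := h1.add h2
  convert h3 using 1
  rw [Algebra.algebraMap_eq_smul_one, Complex.ofReal_sub, sub_smul]
  simp only [Complex.coe_smul]
  abel

omit [DecidableEq m] in
/-- The trace of a positive semidefinite complex matrix has nonnegative real part. [folklore] -/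
theorem PosSemidef.trace_re_nonneg {A : Matrix m m ℂ} (hA : A.PosSemidef) : 0 ≤ A.trace.re :=
  (Complex.nonneg_iff.mp hA.trace_nonneg).1

/-- A polynomial inequality `0 ≤ f + t g + t² h` for all `t ≠ 0` forces `0 ≤ f`. [folklore] -/
theorem nonneg_of_forall_ne_zero_poly {f g h : ℝ}
    (H : ∀ t : ℝ, t ≠ 0 → 0 ≤ f + t * g + t ^ 2 * h) : 0 ≤ f := by
  have hc : Continuous fun t : ℝ => f + t * g + t ^ 2 * h := by fun_prop
  have hlim : Tendsto (fun t : ℝ => f + t * g + t ^ 2 * h) (𝓝[≠] 0) (𝓝 f) := by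
    have := hc.tendsto 0
    simp only [zero_mul, add_zero, ne_eq, OfNat.ofNat_ne_zero, not_false_eq_true, zero_pow] at this
    exact this.mono_left nhdsWithin_le_nhds
  exact ge_of_tendsto hlim (eventually_nhdsWithin_of_forall fun t ht => H t ht)

/-- **Second-order perturbation theory, variationally** (the quadratic form behind the
ground-state infrared bound; Kennedy–Lieb–Shastry, J. Stat. Phys. 53 (1988) 1019, eqs. (18)–(19),
here for the tracial ground state of a possibly degenerate ground level). Let `H`, `V` be Hermitian
and suppose `E₀(H) ≤ E₀(H + tV + ½t²Q)` for all real `t`. Then, with `ω` the tracial ground-state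
functional of `H` and `E₀ = E₀(H)`, for every real `μ`,
`0 ≤ ½Q + 2μ ω(V²) + μ² ω(V (H - E₀) V)`.
Proof: `M_t = H - E₀ + tV + ½t²Q ≥ 0`, so `tr(Φᴴ M_t Φ) ≥ 0` for `Φ = (1 + tμV)P₀`; the order-`t`
term forces `tr(P₀V) = 0`, and the order-`t²` term is the claim times `tr P₀`.
[cite: KLS1988JSP, eqs. (18)–(19)] -/
theorem groundState_infraredBound_quadratic [Nonempty m] {H V : Matrix m m ℂ}
    (hH : H.IsHermitian) (hV : V.IsHermitian) {Q : ℝ}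
    (hGD : ∀ t : ℝ, H.groundEnergy ≤
      (H + (t : ℂ) • V + ((t ^ 2 * Q / 2 : ℝ) : ℂ) • (1 : Matrix m m ℂ)).groundEnergy) (μ : ℝ) :
    0 ≤ Q / 2 + 2 * μ * (H.groundStateFunctional (V * V)).re +
      μ ^ 2 * (H.groundStateFunctional (V * (H - (H.groundEnergy : ℂ) • 1) * V)).re := by
  set P := H.groundProj with hP_def
  set K : Matrix m m ℂ := H - (H.groundEnergy : ℂ) • 1 with hK_def
  have hPh : Pᴴ = P := (groundProj_isHermitian H).eq
  have hPP : P * P = P := groundProj_mul_self H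
  have hKP : K * P = 0 := sub_groundEnergy_mul_groundProj H
  have hPK : P * K = 0 := groundProj_mul_sub_groundEnergy hH
  -- the real numbers of the argument
  set mR : ℝ := P.trace.re with hmR
  set v₁ : ℝ := (P * V).trace.re with hv₁
  set a : ℝ := (P * (V * V)).trace.re with ha
  set b : ℝ := (P * (V * K * V)).trace.re with hb
  set c₃ : ℝ := (P * (V * V * V)).trace.re with hc₃
  have hm : 0 < mR := (Complex.pos_iff.mp (trace_groundProj_pos hH)).1
  have hm_im : P.trace.im = 0 := (Complex.pos_iff.mp (trace_groundProj_pos hH)).2.symm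
  -- Step 0: `M_t ≥ 0`
  have hM : ∀ t : ℝ,
      (K + (t : ℂ) • V + ((t ^ 2 * Q / 2 : ℝ) : ℂ) • (1 : Matrix m m ℂ)).PosSemidef := by
    intro t
    have hX : (H + (t : ℂ) • V + ((t ^ 2 * Q / 2 : ℝ) : ℂ) • (1 : Matrix m m ℂ)).IsHermitian :=
      (hH.add (hV.ofReal_smul t)).add (isHermitian_one.ofReal_smul _)
    have h := posSemidef_sub_of_groundEnergy_le hX (hGD t)
    convert h using 1
    rw [hK_def]
    abel
  -- Step 1: the trace expansion `tr(Φᴴ M Φ)`, `Φ = (1 + sV) P`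
  have htrace : ∀ t s : ℝ,
      ((P + (s : ℂ) • (V * P))ᴴ * (K + (t : ℂ) • V + ((t ^ 2 * Q / 2 : ℝ) : ℂ) • 1) *
          (P + (s : ℂ) • (V * P))).trace =
        (t : ℂ) * (P * V).trace + ((t ^ 2 * Q / 2 : ℝ) : ℂ) * P.trace +
          ((2 * s : ℝ) : ℂ) *
            ((t : ℂ) * (P * (V * V)).trace + ((t ^ 2 * Q / 2 : ℝ) : ℂ) * (P * V).trace) +
          ((s ^ 2 : ℝ) : ℂ) * ((P * (V * K * V)).trace + (t : ℂ) * (P * (V * V * V)).trace +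
            ((t ^ 2 * Q / 2 : ℝ) : ℂ) * (P * (V * V)).trace) := by
    intro t s
    set c : ℝ := t ^ 2 * Q / 2 with hc
    set M : Matrix m m ℂ := K + (t : ℂ) • V + (c : ℂ) • 1 with hM_def
    set Φ : Matrix m m ℂ := P + (s : ℂ) • (V * P) with hΦ
    have hΦh : Φᴴ = P + (s : ℂ) • (P * V) := by
      rw [hΦ, conjTranspose_add, conjTranspose_smul, conjTranspose_mul, hPh, hV.eq,
        Complex.star_def, Complex.conj_ofReal]
    -- `Φ Φᴴ = P + s PV + s VP + s² VPV`
    have hΦΦ : Φ * Φᴴ =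
        P + (s : ℂ) • (P * V) + (s : ℂ) • (V * P) + ((s : ℂ) * (s : ℂ)) • (V * P * V) := by
      have e1 : P * ((s : ℂ) • (P * V)) = (s : ℂ) • (P * V) := by
        rw [Matrix.mul_smul, ← mul_assoc, hPP]
      have e2 : (s : ℂ) • (V * P) * P = (s : ℂ) • (V * P) := by
        rw [Matrix.smul_mul, mul_assoc, hPP]
      have e3 : (s : ℂ) • (V * P) * ((s : ℂ) • (P * V)) = ((s : ℂ) * (s : ℂ)) • (V * P * V) := by
        rw [Matrix.smul_mul, Matrix.mul_smul, smul_smul, ← mul_assoc (V * P) P V, mul_assoc V P P,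
          hPP]
      rw [hΦh, hΦ, add_mul, mul_add, mul_add, hPP, e1, e2, e3]
      abel
    -- the four traces against `M`
    have h1 : (P * M).trace = (t : ℂ) * (P * V).trace + (c : ℂ) * P.trace := by
      rw [hM_def, mul_add, mul_add, hPK, zero_add, trace_add, Matrix.mul_smul, trace_smul,
        Matrix.mul_smul, mul_one, trace_smul, smul_eq_mul, smul_eq_mul]
    have h2 : (P * V * M).trace = (t : ℂ) * (P * (V * V)).trace + (c : ℂ) * (P * V).trace := by
      have hz : (P * V * K).trace = 0 := by
        rw [mul_assoc, trace_mul_cycle', ← mul_assoc, hKP, zero_mul, trace_zero]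
      rw [hM_def, mul_add, mul_add, trace_add, trace_add, Matrix.mul_smul, trace_smul,
        Matrix.mul_smul, mul_one, trace_smul, smul_eq_mul, smul_eq_mul, hz, zero_add, mul_assoc]
    have h3 : (V * P * M).trace = (t : ℂ) * (P * (V * V)).trace + (c : ℂ) * (P * V).trace := by
      have hz : (V * P * K).trace = 0 := by rw [mul_assoc, hPK, mul_zero, trace_zero]
      have hy : (V * P * V).trace = (P * (V * V)).trace := by
        rw [trace_mul_cycle, trace_mul_comm (V * V) P]
      have hx : (V * P).trace = (P * V).trace := trace_mul_comm V P
      rw [hM_def, mul_add, mul_add, trace_add, trace_add, Matrix.mul_smul, trace_smul,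
        Matrix.mul_smul, mul_one, trace_smul, smul_eq_mul, smul_eq_mul, hz, zero_add, hy, hx]
    have h4 : (V * P * V * M).trace = (P * (V * K * V)).trace +
        (t : ℂ) * (P * (V * V * V)).trace + (c : ℂ) * (P * (V * V)).trace := by
      have hx : (V * P * V * K).trace = (P * (V * K * V)).trace := by
        -- `tr(V P V K) = tr(P V K V)`
        rw [mul_assoc (V * P) V K, trace_mul_comm (V * P) (V * K), ← mul_assoc,
          trace_mul_cycle (V * K) V P, mul_assoc P (V * K) V]
      have hy : (V * P * V * V).trace = (P * (V * V * V)).trace := by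
        rw [mul_assoc (V * P) V V, trace_mul_comm (V * P) (V * V), ← mul_assoc,
          trace_mul_cycle (V * V) V P, mul_assoc P (V * V) V]
      have hw : (V * P * V).trace = (P * (V * V)).trace := by
        rw [trace_mul_cycle, trace_mul_comm (V * V) P]
      rw [hM_def, mul_add, mul_add, trace_add, trace_add, Matrix.mul_smul, trace_smul,
        Matrix.mul_smul, mul_one, trace_smul, smul_eq_mul, smul_eq_mul, hx, hy, hw]
    rw [trace_mul_cycle, hΦΦ, add_mul, add_mul, add_mul, trace_add, trace_add, trace_add,
      Matrix.smul_mul, Matrix.smul_mul, Matrix.smul_mul, trace_smul, trace_smul, trace_smul,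
      smul_eq_mul, smul_eq_mul, smul_eq_mul, h1, h2, h3, h4]
    push_cast
    ring
  -- Step 2: the real inequality, for all `t`, `μ`
  have hineq : ∀ t μ : ℝ, 0 ≤ t * v₁ + (t ^ 2 * Q / 2) * mR +
      (2 * (t * μ)) * (t * a + (t ^ 2 * Q / 2) * v₁) +
      (t * μ) ^ 2 * (b + t * c₃ + (t ^ 2 * Q / 2) * a) := by
    intro t μ
    have hpsd := (hM t).conjTranspose_mul_mul_same (P + ((t * μ : ℝ) : ℂ) • (V * P))
    have h0 := hpsd.trace_re_nonneg
    rw [htrace t (t * μ)] at h0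
    simpa only [Complex.add_re, Complex.re_ofReal_mul, ← hmR, ← hv₁, ← ha, ← hb, ← hc₃] using h0
  -- Step 3: first order, `tr(P V) = 0`
  have hv0 : v₁ = 0 := by
    have hq : ∀ x : ℝ, 0 ≤ Q / 2 * mR * (x * x) + v₁ * x + 0 := by
      intro x
      have := hineq x 0
      simp only [mul_zero, zero_mul, add_zero, ne_eq, OfNat.ofNat_ne_zero, not_false_eq_true,
        zero_pow] at this
      nlinarith [this]
    have hd := discrim_le_zero hq
    rw [discrim] at hd
    nlinarith [sq_nonneg v₁]
  -- Step 4: second order, `½Q tr P + 2μ a + μ² b ≥ 0`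
  have hquad : ∀ μ : ℝ, 0 ≤ b * (μ * μ) + 2 * a * μ + Q / 2 * mR := by
    intro μ
    refine nonneg_of_forall_ne_zero_poly (g := μ ^ 2 * c₃) (h := μ ^ 2 * (Q / 2) * a)
      fun t ht => ?_
    have h1 := hineq t μ
    rw [hv0] at h1
    have ht2 : 0 < t ^ 2 := by positivity
    refine (mul_nonneg_iff_of_pos_left ht2).1 ?_
    nlinarith [h1]
  -- Step 5: back to `ω`
  have htrP : P.trace = (mR : ℂ) := Complex.ext (by simp [hmR]) (by simp [hm_im])
  have hω : ∀ O : Matrix m m ℂ, (H.groundStateFunctional O).re = mR⁻¹ * (P * O).trace.re := by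
    intro O
    rw [groundStateFunctional_apply, ← hP_def, htrP, ← Complex.ofReal_inv, Complex.re_ofReal_mul]
  rw [hω, hω, ← ha, show P * (V * K * V) = P * (V * K * V) from rfl, ← hb]
  have hmm : mR⁻¹ * mR = 1 := inv_mul_cancel₀ hm.ne'
  calc (0 : ℝ) ≤ mR⁻¹ * (b * (μ * μ) + 2 * a * μ + Q / 2 * mR) :=
        mul_nonneg (inv_pos.2 hm).le (hquad μ)
    _ = Q / 2 + 2 * μ * (mR⁻¹ * a) + μ ^ 2 * (mR⁻¹ * b) := by
        linear_combination (Q / 2) * hmm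

/-- **The ground-state infrared bound from Gaussian domination** (abstract form of
Kennedy–Lieb–Shastry's direct ground-state argument, J. Stat. Phys. 53 (1988) 1019, eqs. (12),
(14), (18), (19)): under the hypotheses of `groundState_infraredBound_quadratic`,
`(ω(V²))² ≤ ½ Q · ω(V (H - E₀) V)` (the discriminant of the quadratic form in `μ`; the
Cauchy–Schwarz step (12) with the susceptibility bound (14) of the source).
[cite: KLS1988JSP, eqs. (12), (14), (18)–(19)] -/
theorem groundState_infraredBound [Nonempty m] {H V : Matrix m m ℂ} (hH : H.IsHermitian)
    (hV : V.IsHermitian) {Q : ℝ}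
    (hGD : ∀ t : ℝ, H.groundEnergy ≤
      (H + (t : ℂ) • V + ((t ^ 2 * Q / 2 : ℝ) : ℂ) • (1 : Matrix m m ℂ)).groundEnergy) :
    (H.groundStateFunctional (V * V)).re ^ 2 ≤
      Q / 2 * (H.groundStateFunctional (V * (H - (H.groundEnergy : ℂ) • 1) * V)).re := by
  have hq : ∀ x : ℝ, 0 ≤ (H.groundStateFunctional (V * (H - (H.groundEnergy : ℂ) • 1) * V)).re *
      (x * x) + 2 * (H.groundStateFunctional (V * V)).re * x + Q / 2 := by
    intro x
    have h := groundState_infraredBound_quadratic hH hV hGD x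
    linarith [h]
  have hd := discrim_le_zero hq
  rw [discrim] at hd
  nlinarith [hd]

/-- The same bound with the double commutator: `ω(V (H - E₀) V) = ½ ω([V, [H, V]])`, so
`(ω(V²))² ≤ ¼ Q · ω([V, [H, V]])`. [Kennedy–Lieb–Shastry, J. Stat. Phys. 53 (1988), eqs.
(12)–(13)] [cite: KLS1988JSP, eqs. (12)–(13)] -/
theorem groundStateFunctional_mul_sub_groundEnergy_mul {H : Matrix m m ℂ} (hH : H.IsHermitian)
    (V : Matrix m m ℂ) :
    H.groundStateFunctional (V * (H - (H.groundEnergy : ℂ) • 1) * V) =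
      (1 / 2 : ℂ) * H.groundStateFunctional (V * (H * V) - V * (V * H) - (H * V * V - V * (H * V))) := by
  -- `ω(X H) = E₀ ω(X) = ω(H X)`
  have h1 := groundStateFunctional_mul_hamiltonian H (V * V)
  have h2 := groundStateFunctional_hamiltonian_mul hH (V * V)
  rw [mul_sub, sub_mul, Matrix.mul_smul, mul_one, Matrix.smul_mul, map_sub, map_sub, map_sub,
    map_sub, LinearMap.map_smul_of_tower]
  rw [show V * (V * H) = V * V * H by rw [mul_assoc], h1, show H * V * V = H * (V * V) by
    rw [mul_assoc], h2, ← mul_assoc, smul_eq_mul]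
  ring

end Matrix

namespace Literature.MathematicalPhysics.QuantumLattice

variable {d : ℕ}

-- Mathlib idiom (as in `Mathlib.Algebra.Lie.OfAssociative`): the commutator Lie-ring structure
-- `⁅a, b⁆ = ab - ba` of an associative ring is a `def`, enabled locally; it agrees definitionally
-- with the ring bracket `Ring.instBracket`.
attribute [local instance 100] LieRing.ofAssociativeRing

/-! ### Fourier analysis of the two modes on the dual torus -/

section Fourier

variable (L : ℕ) [NeZero L]

/-- `Im χ_q(z) = sin (q · z)`. [folklore] -/
theorem torusChar_im (q z : TorusSite d L) :
    (∏ j, (ZMod.stdAddChar (q j * z j) : ℂ)).im = Real.sin (torusPhase L q z) := by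
  rw [torusChar_eq_exp, Complex.exp_ofReal_mul_I_im]

/-- The addition theorem on the torus (exact, through the characters):
`cos(q·(x-y)) = cos(q·x) cos(q·y) + sin(q·x) sin(q·y)`. [folklore] -/
theorem cos_torusPhase_sub (q x y : TorusSite d L) :
    Real.cos (torusPhase L q (x - y)) =
      Real.cos (torusPhase L q x) * Real.cos (torusPhase L q y) +
        Real.sin (torusPhase L q x) * Real.sin (torusPhase L q y) := by
  rw [← torusChar_re, ← torusChar_re L q x, ← torusChar_re L q y, ← torusChar_im L q x,
    ← torusChar_im L q y, sub_eq_add_neg, torusChar_add, torusChar_neg]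
  simp only [Complex.mul_re, Complex.star_def, Complex.conj_re, Complex.conj_im]
  ring

/-- `sin(q·z) cos qᵢ = ½ (sin(q·(z+eᵢ)) + sin(q·(z-eᵢ)))`. [folklore] -/
theorem sin_torusPhase_mul_cos_latticeMomentum (q z : TorusSite d L) (i : Fin d) :
    Real.sin (torusPhase L q z) * Real.cos (latticeMomentum L q i) =
      (Real.sin (torusPhase L q (z + Pi.single i 1)) +
        Real.sin (torusPhase L q (z - Pi.single i 1))) / 2 := by
  rw [← torusChar_im, ← torusChar_single_re, ← torusChar_im, ← torusChar_im, torusChar_add,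
    sub_eq_add_neg, torusChar_add, torusChar_neg]
  simp only [Complex.mul_im, Complex.star_def, Complex.conj_re, Complex.conj_im]
  ring

/-- `cos(q·(-eᵢ)) = cos qᵢ`. [folklore] -/
theorem cos_torusPhase_neg_single (q : TorusSite d L) (i : Fin d) :
    Real.cos (torusPhase L q (-Pi.single i 1)) = Real.cos (latticeMomentum L q i) := by
  rw [← torusChar_re, ← torusChar_single_re, torusChar_neg, Complex.star_def, Complex.conj_re]

omit [NeZero L] in
/-- `cos²(q·x) + sin²(q·x) = 1`, in the product form used below. [folklore] -/
theorem cos_sq_add_sin_sq_torusPhase (q x : TorusSite d L) :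
    Real.cos (torusPhase L q x) * Real.cos (torusPhase L q x) +
      Real.sin (torusPhase L q x) * Real.sin (torusPhase L q x) = 1 := by
  nlinarith [Real.cos_sq_add_sin_sq (torusPhase L q x)]

/-- The discrete Laplacian of the cosine wave: `Σᵢ (2cos(q·x) - cos(q·(x+eᵢ)) - cos(q·(x-eᵢ)))
= 2 E_q cos(q·x)`, `E_q = Σᵢ (1 - cos qᵢ)` (Dyson–Lieb–Simon 1978, §3). [folklore] -/
theorem laplacian_cos_torusPhase (q x : TorusSite d L) :
    ∑ i : Fin d, (2 * Real.cos (torusPhase L q x) - Real.cos (torusPhase L q (x + Pi.single i 1)) -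
      Real.cos (torusPhase L q (x - Pi.single i 1))) =
      2 * dispersion (latticeMomentum L q) * Real.cos (torusPhase L q x) := by
  rw [dispersion, mul_sum, sum_mul]
  refine sum_congr rfl fun i _ => ?_
  have h := cos_torusPhase_mul_cos_latticeMomentum L q x i
  linarith

/-- The discrete Laplacian of the sine wave. [folklore] -/
theorem laplacian_sin_torusPhase (q x : TorusSite d L) :
    ∑ i : Fin d, (2 * Real.sin (torusPhase L q x) - Real.sin (torusPhase L q (x + Pi.single i 1)) -
      Real.sin (torusPhase L q (x - Pi.single i 1))) =
      2 * dispersion (latticeMomentum L q) * Real.sin (torusPhase L q x) := by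
  rw [dispersion, mul_sum, sum_mul]
  refine sum_congr rfl fun i _ => ?_
  have h := sin_torusPhase_mul_cos_latticeMomentum L q x i
  linarith

end Fourier

/-! ### The field term of a wave is the wave of its Laplacian -/

section GradField

variable (L : ℕ) [NeZero L] (n : ℕ)

/-- Summation by parts on the torus: `V_h = Σ_x (Σᵢ (2h_x - h_{x+eᵢ} - h_{x-eᵢ})) S¹_x`.
[folklore] -/
theorem xyGradField_eq_sum_laplacian (h : TorusSite d L → ℝ) :
    xyGradField L n h = ∑ x : TorusSite d L,
      ((∑ i : Fin d, (2 * h x - h (x + Pi.single i 1) - h (x - Pi.single i 1)) : ℝ) : ℂ) •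
        siteSpin n x 0 := by
  have hL : xyGradField L n h =
      (∑ x : TorusSite d L, ∑ i : Fin d, ((h x - h (x + Pi.single i 1) : ℝ) : ℂ) • siteSpin n x 0) -
        ∑ x : TorusSite d L, ∑ i : Fin d,
          ((h x - h (x + Pi.single i 1) : ℝ) : ℂ) • siteSpin n (x + Pi.single i 1) 0 := by
    unfold xyGradField
    rw [← sum_sub_distrib]
    refine sum_congr rfl fun x _ => ?_
    rw [← sum_sub_distrib]
    exact sum_congr rfl fun i _ => smul_sub _ _ _
  -- reindex the second sum, `x ↦ x - eᵢ`
  have hre : ∀ i : Fin d, ∑ x : TorusSite d L,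
      ((h x - h (x + Pi.single i 1) : ℝ) : ℂ) • siteSpin n (x + Pi.single i 1) 0 =
        ∑ x : TorusSite d L, ((h (x - Pi.single i 1) - h x : ℝ) : ℂ) • siteSpin n x 0 := by
    intro i
    rw [← (Equiv.subRight (Pi.single i (1 : ZMod L))).sum_comp]
    refine sum_congr rfl fun x _ => ?_
    simp only [Equiv.subRight_apply, sub_add_cancel]
  have h2 : ∑ x : TorusSite d L, ∑ i : Fin d,
      ((h x - h (x + Pi.single i 1) : ℝ) : ℂ) • siteSpin n (x + Pi.single i 1) 0 =
        ∑ x : TorusSite d L, ∑ i : Fin d, ((h (x - Pi.single i 1) - h x : ℝ) : ℂ) • siteSpin n x 0 := by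
    rw [sum_comm, sum_congr rfl fun i _ => hre i, sum_comm]
  rw [hL, h2, ← sum_sub_distrib]
  refine sum_congr rfl fun x _ => ?_
  rw [← sum_sub_distrib, Complex.ofReal_sum, sum_smul]
  refine sum_congr rfl fun i _ => ?_
  rw [← sub_smul, ← Complex.ofReal_sub]
  congr 1
  push_cast
  ring

/-- `V_{cos(q·)} = 2E_q C_q`. [Dyson–Lieb–Simon 1978, §3; Kennedy–Lieb–Shastry, J. Stat. Phys.
53 (1988), after eq. (19)] [folklore] -/
theorem xyGradField_cos (q : TorusSite d L) :
    xyGradField L n (fun x => Real.cos (torusPhase L q x)) =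
      ((2 * dispersion (latticeMomentum L q) : ℝ) : ℂ) • xyCosMode L n q := by
  rw [xyGradField_eq_sum_laplacian, xyCosMode, smul_sum]
  refine sum_congr rfl fun x _ => ?_
  rw [laplacian_cos_torusPhase, smul_smul, ← Complex.ofReal_mul]

/-- `V_{sin(q·)} = 2E_q D_q`. [folklore] -/
theorem xyGradField_sin (q : TorusSite d L) :
    xyGradField L n (fun x => Real.sin (torusPhase L q x)) =
      ((2 * dispersion (latticeMomentum L q) : ℝ) : ℂ) • xySinMode L n q := by
  rw [xyGradField_eq_sum_laplacian, xySinMode, smul_sum]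
  refine sum_congr rfl fun x _ => ?_
  rw [laplacian_sin_torusPhase, smul_smul, ← Complex.ofReal_mul]

/-- `Q(cos(q·)) + Q(sin(q·)) = 2 E_q |Λ|`: `(c_x - c_y)² + (s_x - s_y)² = 2 - 2cos(q·(x-y))`, and
`cos(q·(-eᵢ)) = cos qᵢ`. [Dyson–Lieb–Simon 1978, §3] [folklore] -/
theorem xyFieldEnergy_cos_add_sin (q : TorusSite d L) :
    xyFieldEnergy L (fun x => Real.cos (torusPhase L q x)) +
        xyFieldEnergy L (fun x => Real.sin (torusPhase L q x)) =
      2 * dispersion (latticeMomentum L q) * (L : ℝ) ^ d := by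
  unfold xyFieldEnergy
  rw [← sum_add_distrib]
  have hx : ∀ x : TorusSite d L, (∑ i : Fin d, (Real.cos (torusPhase L q x) -
      Real.cos (torusPhase L q (x + Pi.single i 1))) ^ 2 +
      ∑ i : Fin d, (Real.sin (torusPhase L q x) - Real.sin (torusPhase L q (x + Pi.single i 1))) ^ 2)
      = 2 * dispersion (latticeMomentum L q) := by
    intro x
    rw [← sum_add_distrib, dispersion, mul_sum]
    refine sum_congr rfl fun i _ => ?_
    have h1 := cos_sq_add_sin_sq_torusPhase L q x
    have h2 := cos_sq_add_sin_sq_torusPhase L q (x + Pi.single i 1)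
    have h3 := cos_torusPhase_sub L q x (x + Pi.single i 1)
    rw [sub_add_cancel_left, cos_torusPhase_neg_single] at h3
    nlinarith [h1, h2, h3]
  rw [sum_congr rfl fun x _ => hx x, sum_const, card_univ, nsmul_eq_mul, Fintype.card_pi,
    prod_const, ZMod.card, card_univ, Fintype.card_fin, Nat.cast_pow]
  ring

end GradField

/-! ### The structure factor through the two modes -/

section StructureFactor

variable (L : ℕ) [NeZero L] (n : ℕ)

/-- `ω(A_a A_b) = Σ_{x,y} a_x b_y ω(S¹_x S¹_y)` for real coefficient families. [folklore] -/
theorem groundStateFunctional_wave_mul_wave (a b : TorusSite d L → ℝ) :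
    (xyTorus d L n).groundStateFunctional
        ((∑ x : TorusSite d L, (a x : ℂ) • siteSpin n x 0) *
          ∑ y : TorusSite d L, (b y : ℂ) • siteSpin n y 0) =
      ∑ x : TorusSite d L, ∑ y : TorusSite d L, ((a x * b y : ℝ) : ℂ) *
        (xyTorus d L n).groundStateFunctional (siteSpin n x 0 * siteSpin n y 0) := by
  rw [sum_mul_sum, map_sum]
  refine sum_congr rfl fun x _ => ?_
  rw [map_sum]
  refine sum_congr rfl fun y _ => ?_
  rw [smul_mul_assoc, mul_smul_comm, smul_smul, LinearMap.map_smul, smul_eq_mul,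
    Complex.ofReal_mul]

/-- **The structure factor through the modes**:
`L^d ĝ¹_q = ω(C_q²) + ω(D_q²)` (real parts). [Kennedy–Lieb–Shastry 1988, def. of `g_p`]
[folklore] -/
theorem xyStructureFactor_eq_modes (q : TorusSite d L) :
    xyStructureFactor 0 L n q * (L : ℝ) ^ d =
      ((xyTorus d L n).groundStateFunctional (xyCosMode L n q * xyCosMode L n q)).re +
        ((xyTorus d L n).groundStateFunctional (xySinMode L n q * xySinMode L n q)).re := by
  have hL : (0 : ℝ) < (L : ℝ) ^ d := by
    have : (0 : ℝ) < L := by exact_mod_cast Nat.pos_of_ne_zero (NeZero.ne L)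
    positivity
  rw [xyStructureFactor_of_neZero, div_mul_cancel₀ _ hL.ne', xyCosMode, xySinMode,
    groundStateFunctional_wave_mul_wave, groundStateFunctional_wave_mul_wave, Complex.re_sum,
    Complex.re_sum, ← sum_add_distrib]
  refine sum_congr rfl fun x _ => ?_
  rw [Complex.re_sum, Complex.re_sum, ← sum_add_distrib]
  refine sum_congr rfl fun y _ => ?_
  rw [Complex.re_ofReal_mul, Complex.re_ofReal_mul, xyGroundCorr_of_neZero, cos_torusPhase_sub]
  ring

end StructureFactor


/-! ### The double commutator `[A, [H, A]]` for a wave `A = Σ_x a_x S¹_x` of the first component -/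

section LieHelpers

variable {R : Type*} [Ring R]

/-- `[a, bc] = [a, b] c` when `a` commutes with `c`. [folklore] -/
theorem lie_mul_of_commute_right {a c : R} (b : R) (h : Commute a c) :
    ⁅a, b * c⁆ = ⁅a, b⁆ * c := by
  rw [Ring.lie_def, Ring.lie_def, sub_mul, mul_assoc b c a, ← h.eq, ← mul_assoc, ← mul_assoc]

/-- `[a, cb] = c [a, b]` when `a` commutes with `c`. [folklore] -/
theorem lie_mul_of_commute_left {a c : R} (b : R) (h : Commute a c) :
    ⁅a, c * b⁆ = c * ⁅a, b⁆ := by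
  rw [Ring.lie_def, Ring.lie_def, mul_sub, ← mul_assoc, h.eq, mul_assoc, mul_assoc]

end LieHelpers

section SiteAlgebra

variable {Λ : Type*} [Fintype Λ] [DecidableEq Λ] (n : ℕ)

/-- On-site commutators: `[S^α_x, S^β_x] = (𝟙 ⊗ [S^α, S^β] ⊗ 𝟙)`. [folklore] -/
theorem lie_siteSpin_same (x : Λ) (α β : Fin 3) :
    ⁅(siteSpin n x α : Op Λ (n + 1)), siteSpin n x β⁆ = onSite x ⁅spinVec n α, spinVec n β⁆ := by
  rw [Ring.lie_def, Ring.lie_def, siteSpin, siteSpin, onSite_mul, onSite_mul, onSite_sub']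

/-- `[S¹_x, S²_x] = i S³_x` (components `0, 1, 2`). Tasaki (2020) §2.1, eq. (2.1.1). [folklore] -/
theorem lie_siteSpin_zero_one (x : Λ) :
    ⁅(siteSpin n x 0 : Op Λ (n + 1)), siteSpin n x 1⁆ = Complex.I • siteSpin n x 2 := by
  rw [lie_siteSpin_same, spinVec_zero, spinVec_one, lie_spinX_spinY, onSite_smul']
  rfl

/-- `[S¹_x, S³_x] = -i S²_x`. Tasaki (2020) §2.1, eq. (2.1.1). [folklore] -/
theorem lie_siteSpin_zero_two (x : Λ) :
    ⁅(siteSpin n x 0 : Op Λ (n + 1)), siteSpin n x 2⁆ = -Complex.I • siteSpin n x 1 := by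
  rw [← lie_skew, lie_siteSpin_same, spinVec_zero, spinVec_two, lie_spinZ_spinX, onSite_smul',
    neg_smul]
  rfl

variable {n}

/-- For `x ≠ y` the symmetrised bond operator is the plain product: `spinBond α x y = S^α_x S^α_y`.
[folklore] -/
theorem spinBond_eq_mul_of_ne {x y : Λ} (hxy : x ≠ y) (α : Fin 3) :
    spinBond n α x y = siteSpin n x α * siteSpin n y α := by
  rw [spinBond, (siteSpin_commute_of_ne_holds n hxy α α).eq.symm, ← two_smul ℂ, smul_smul]
  norm_num

/-- **The bond double commutator.** For `x ≠ y`, `B = S¹_x S¹_y + S²_x S²_y` and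
`A = Σ_u a_u S¹_u`:
`[A, [B, A]] = -(a_x² + a_y²) S²_x S²_y + 2 a_x a_y S³_x S³_y`.
[Kennedy–Lieb–Shastry, J. Stat. Phys. 53 (1988), eq. (13) ("after some computation"), XY
version] [folklore] -/
theorem lie_lie_bond (a : Λ → ℂ) {x y : Λ} (hxy : x ≠ y) :
    ⁅(∑ u : Λ, a u • (siteSpin n u 0 : Op Λ (n + 1))),
      ⁅siteSpin n x 0 * siteSpin n y 0 + siteSpin n x 1 * siteSpin n y 1,
        ∑ u : Λ, a u • (siteSpin n u 0 : Op Λ (n + 1))⁆⁆ =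
      -(a x ^ 2 + a y ^ 2) • (siteSpin n x 1 * siteSpin n y 1) +
        (2 * a x * a y) • (siteSpin n x 2 * siteSpin n y 2) := by
  -- notation
  set X0 : Op Λ (n + 1) := siteSpin n x 0
  set X1 : Op Λ (n + 1) := siteSpin n x 1
  set X2 : Op Λ (n + 1) := siteSpin n x 2
  set Y0 : Op Λ (n + 1) := siteSpin n y 0
  set Y1 : Op Λ (n + 1) := siteSpin n y 1
  set Y2 : Op Λ (n + 1) := siteSpin n y 2
  set B : Op Λ (n + 1) := X0 * Y0 + X1 * Y1 with hB
  have hc : ∀ {u v : Λ} (huv : u ≠ v) (α β : Fin 3),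
      Commute (siteSpin n u α : Op Λ (n + 1)) (siteSpin n v β) :=
    fun huv α β => siteSpin_commute_of_ne_holds n huv α β
  -- `[B, S¹_v] = 0` off the bond
  have hB0 : ∀ v, v ≠ x ∧ v ≠ y → ⁅B, (siteSpin n v 0 : Op Λ (n + 1))⁆ = 0 := by
    rintro v ⟨hvx, hvy⟩
    refine Commute.lie_eq ?_
    exact ((hc hvx.symm 0 0).mul_left (hc hvy.symm 0 0)).add_left
      ((hc hvx.symm 1 0).mul_left (hc hvy.symm 1 0))
  -- `[B, S¹_x] = -i S³_x S²_y`, `[B, S¹_y] = -i S²_x S³_y`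
  have hBx : ⁅B, X0⁆ = -Complex.I • (X2 * Y1) := by
    rw [hB, add_lie, ← lie_skew, lie_mul_of_commute_right X0 (hc hxy 0 0), lie_self, zero_mul,
      neg_zero, zero_add, ← lie_skew, lie_mul_of_commute_right X1 (hc hxy 0 1),
      lie_siteSpin_zero_one, smul_mul_assoc, ← neg_smul]
  have hBy : ⁅B, Y0⁆ = -Complex.I • (X1 * Y2) := by
    rw [hB, add_lie, ← lie_skew, lie_mul_of_commute_left Y0 (hc hxy.symm 0 0), lie_self,
      mul_zero, neg_zero, zero_add, ← lie_skew, lie_mul_of_commute_left Y1 (hc hxy.symm 0 1),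
      lie_siteSpin_zero_one, mul_smul_comm, ← neg_smul]
  -- `[B, A] = a_x [B, S¹_x] + a_y [B, S¹_y]`
  have hBA : ⁅B, ∑ u : Λ, a u • (siteSpin n u 0 : Op Λ (n + 1))⁆ =
      (-Complex.I * a x) • (X2 * Y1) + (-Complex.I * a y) • (X1 * Y2) := by
    rw [lie_sum, Fintype.sum_eq_add x y hxy (fun v hv => by rw [lie_smul, hB0 v hv, smul_zero]),
      lie_smul, lie_smul, hBx, hBy, smul_smul, smul_smul, mul_comm (a x), mul_comm (a y)]
  -- second commutators
  have hx1 : ⁅X0, X2 * Y1⁆ = -Complex.I • (X1 * Y1) := by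
    rw [lie_mul_of_commute_right X2 (hc hxy 0 1), lie_siteSpin_zero_two, smul_mul_assoc]
  have hx2 : ⁅X0, X1 * Y2⁆ = Complex.I • (X2 * Y2) := by
    rw [lie_mul_of_commute_right X1 (hc hxy 0 2), lie_siteSpin_zero_one, smul_mul_assoc]
  have hy1 : ⁅Y0, X2 * Y1⁆ = Complex.I • (X2 * Y2) := by
    rw [lie_mul_of_commute_left Y1 (hc hxy.symm 0 2), lie_siteSpin_zero_one, mul_smul_comm]
  have hy2 : ⁅Y0, X1 * Y2⁆ = -Complex.I • (X1 * Y1) := by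
    rw [lie_mul_of_commute_left Y2 (hc hxy.symm 0 1), lie_siteSpin_zero_two, mul_smul_comm]
  have hu0 : ∀ u, u ≠ x ∧ u ≠ y →
      ⁅(siteSpin n u 0 : Op Λ (n + 1)), (-Complex.I * a x) • (X2 * Y1) + (-Complex.I * a y) • (X1 * Y2)⁆
        = 0 := by
    rintro u ⟨hux, huy⟩
    refine Commute.lie_eq ?_
    exact (((hc hux 0 2).mul_right (hc huy 0 1)).smul_right _).add_right
      (((hc hux 0 1).mul_right (hc huy 0 2)).smul_right _)
  have hII : (-Complex.I) * (-Complex.I) = -1 := by rw [neg_mul_neg, Complex.I_mul_I]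
  have hII' : (-Complex.I) * Complex.I = 1 := by rw [neg_mul, Complex.I_mul_I, neg_neg]
  rw [hBA, sum_lie, Fintype.sum_eq_add x y hxy (fun u hu => by rw [smul_lie, hu0 u hu, smul_zero]),
    smul_lie, smul_lie, lie_add, lie_add, lie_smul, lie_smul, lie_smul, lie_smul, hx1, hx2, hy1,
    hy2]
  simp only [smul_smul, smul_add, ← mul_assoc]
  have e1 : a x * -Complex.I * a x * -Complex.I = -(a x ^ 2) := by
    linear_combination (a x ^ 2) * hII
  have e2 : a x * -Complex.I * a y * Complex.I = a x * a y := by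
    linear_combination (a x * a y) * hII'
  have e3 : a y * -Complex.I * a x * Complex.I = a x * a y := by
    linear_combination (a x * a y) * hII'
  have e4 : a y * -Complex.I * a y * -Complex.I = -(a y ^ 2) := by
    linear_combination (a y ^ 2) * hII
  rw [e1, e2, e3, e4]
  module

end SiteAlgebra

section HamiltonianDC

variable (L : ℕ) [NeZero L] (n : ℕ)

/-- Edges of a simple graph join distinct vertices (membership form). [folklore] -/
theorem ne_of_mk_mem_edgeFinset {V : Type*} [Fintype V] [DecidableEq V] {G : SimpleGraph V}
    [DecidableRel G.Adj] {x y : V} (h : s(x, y) ∈ G.edgeFinset) : x ≠ y :=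
  SimpleGraph.ne_of_adj _ (by rwa [SimpleGraph.mem_edgeFinset, SimpleGraph.mem_edgeSet] at h)

/-- **The double commutator of the XY Hamiltonian with a wave of the first component**:
for `A = Σ_u a_u S¹_u` and `H = -Σ_{⟨xy⟩} (S¹_x S¹_y + S²_x S²_y)`,
`[A, [H, A]] = Σ_{⟨xy⟩} ((a_x² + a_y²) S²_x S²_y - 2 a_x a_y S³_x S³_y)`.
[Kennedy–Lieb–Shastry, J. Stat. Phys. 53 (1988), eq. (13), XY version; Kennedy–Lieb–Shastry 1988,
the numerator of eq. (4)] [folklore] -/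
theorem lie_lie_xyTorus (a : TorusSite d L → ℂ) :
    ⁅(∑ u : TorusSite d L, a u • (siteSpin n u 0 : Op (TorusSite d L) (n + 1))),
      ⁅xyTorus d L n, ∑ u : TorusSite d L, a u • (siteSpin n u 0 : Op (TorusSite d L) (n + 1))⁆⁆ =
      ∑ e ∈ (torusGraph d L).edgeFinset,
        Sym2.lift ⟨fun x y => (a x ^ 2 + a y ^ 2) • spinBond n 1 x y -
          (2 * a x * a y) • spinBond n 2 x y, fun x y => by
            dsimp only
            rw [spinBond_comm n 1 x y, spinBond_comm n 2 x y, add_comm (a y ^ 2) (a x ^ 2),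
              mul_right_comm 2 (a y) (a x)]⟩ e := by
  rw [xyTorus_eq_bondSum (d := d) L n, sum_lie (torusGraph d L).edgeFinset,
    lie_sum (torusGraph d L).edgeFinset]
  refine sum_congr rfl fun e he => ?_
  revert he
  refine Sym2.ind (fun x y => ?_) e
  intro he
  have hxy : x ≠ y := ne_of_mk_mem_edgeFinset he
  simp only [Sym2.lift_mk]
  have hT : ((-1 : ℝ) : ℂ) • spinBond n 0 x y + ((-1 : ℝ) : ℂ) • spinBond n 1 x y +
      ((0 : ℝ) : ℂ) • spinBond n 2 x y =
      -((siteSpin n x 0 * siteSpin n y 0 + siteSpin n x 1 * siteSpin n y 1 :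
        Op (TorusSite d L) (n + 1))) := by
    rw [spinBond_eq_mul_of_ne hxy 0, spinBond_eq_mul_of_ne hxy 1]
    push_cast
    module
  rw [hT, neg_lie, lie_neg, lie_lie_bond a hxy, spinBond_eq_mul_of_ne hxy 1,
    spinBond_eq_mul_of_ne hxy 2]
  module

/-- The ground-state expectation of the double commutator, edge by edge:
`Re ω([A, [H, A]]) = Σ_{⟨xy⟩} ((a_x² + a_y²) G²(x,y) - 2 a_x a_y G³(x,y))` for a real wave `a`
(`G^α(x,y) = Re ω(S^α_x S^α_y)`, components `α = 1, 2`). [Kennedy–Lieb–Shastry, J. Stat. Phys. 53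
(1988), eq. (13)] [folklore] -/
theorem re_groundStateFunctional_lie_lie (a : TorusSite d L → ℝ) :
    ((xyTorus d L n).groundStateFunctional
      ⁅(∑ u : TorusSite d L, (a u : ℂ) • (siteSpin n u 0 : Op (TorusSite d L) (n + 1))),
        ⁅xyTorus d L n,
          ∑ u : TorusSite d L, (a u : ℂ) • (siteSpin n u 0 : Op (TorusSite d L) (n + 1))⁆⁆).re =
      ∑ e ∈ (torusGraph d L).edgeFinset,
        Sym2.lift ⟨fun x y => (a x ^ 2 + a y ^ 2) * xyGroundCorr 1 L n x y -
          2 * a x * a y * xyGroundCorr 2 L n x y, fun x y => by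
            dsimp only
            rw [xyGroundCorr_symm 1 L n x y, xyGroundCorr_symm 2 L n x y]; ring⟩ e := by
  rw [lie_lie_xyTorus, map_sum, Complex.re_sum]
  refine sum_congr rfl fun e _ => ?_
  refine Sym2.ind (fun x y => ?_) e
  simp only [Sym2.lift_mk, map_sub, LinearMap.map_smul, smul_eq_mul, Complex.sub_re]
  rw [show ((a x : ℂ) ^ 2 + (a y : ℂ) ^ 2) = ((a x ^ 2 + a y ^ 2 : ℝ) : ℂ) by push_cast; ring,
    show (2 * (a x : ℂ) * (a y : ℂ)) = ((2 * a x * a y : ℝ) : ℂ) by push_cast; ring,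
    Complex.re_ofReal_mul, Complex.re_ofReal_mul, re_groundStateFunctional_spinBond,
    re_groundStateFunctional_spinBond]

/-- **The two modes together**: for side `L ≥ 3`,
`Re ω([C_q,[H,C_q]]) + Re ω([D_q,[H,D_q]]) = 2 Σᵢ Σ_z (G²(z,z+eᵢ) - cos qᵢ G³(z,z+eᵢ))`
(`cos² + sin² = 1`, `cos(q·x)cos(q·y) + sin(q·x)sin(q·y) = cos(q·(x-y))`, and each edge of the torus
graph is `{z, z+eᵢ}` for exactly one pair `(z,i)`). [Kennedy–Lieb–Shastry 1988, eq. (4), the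
numerator; Dyson–Lieb–Simon 1978, §3] [folklore] -/
theorem re_groundStateFunctional_lie_lie_modes (hL : 3 ≤ L) (q : TorusSite d L) :
    ((xyTorus d L n).groundStateFunctional ⁅xyCosMode L n q, ⁅xyTorus d L n, xyCosMode L n q⁆⁆).re +
      ((xyTorus d L n).groundStateFunctional ⁅xySinMode L n q, ⁅xyTorus d L n, xySinMode L n q⁆⁆).re =
      2 * ∑ i : Fin d, ∑ z : TorusSite d L,
        (xyGroundCorr 1 L n z (z + Pi.single i 1) -
          Real.cos (latticeMomentum L q i) * xyGroundCorr 2 L n z (z + Pi.single i 1)) := by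
  rw [xyCosMode, xySinMode, re_groundStateFunctional_lie_lie, re_groundStateFunctional_lie_lie,
    ← sum_add_distrib]
  -- combine the two edge functions
  have hcomb : ∀ e ∈ (torusGraph d L).edgeFinset,
      Sym2.lift ⟨fun x y => (Real.cos (torusPhase L q x) ^ 2 + Real.cos (torusPhase L q y) ^ 2) *
          xyGroundCorr 1 L n x y - 2 * Real.cos (torusPhase L q x) * Real.cos (torusPhase L q y) *
          xyGroundCorr 2 L n x y, fun x y => by
            dsimp only
            rw [xyGroundCorr_symm 1 L n x y, xyGroundCorr_symm 2 L n x y]; ring⟩ e +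
        Sym2.lift ⟨fun x y => (Real.sin (torusPhase L q x) ^ 2 + Real.sin (torusPhase L q y) ^ 2) *
          xyGroundCorr 1 L n x y - 2 * Real.sin (torusPhase L q x) * Real.sin (torusPhase L q y) *
          xyGroundCorr 2 L n x y, fun x y => by
            dsimp only
            rw [xyGroundCorr_symm 1 L n x y, xyGroundCorr_symm 2 L n x y]; ring⟩ e =
      2 * Sym2.lift ⟨fun x y => xyGroundCorr 1 L n x y -
          Real.cos (torusPhase L q (x - y)) * xyGroundCorr 2 L n x y, fun x y => by
            dsimp only
            rw [xyGroundCorr_symm 1 L n x y, xyGroundCorr_symm 2 L n x y, cos_torusPhase_sub,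
              cos_torusPhase_sub]; ring⟩ e := by
    intro e _
    refine Sym2.ind (fun x y => ?_) e
    simp only [Sym2.lift_mk]
    rw [cos_torusPhase_sub]
    linear_combination (xyGroundCorr 1 L n x y) * Real.cos_sq_add_sin_sq (torusPhase L q x) +
      (xyGroundCorr 1 L n x y) * Real.cos_sq_add_sin_sq (torusPhase L q y)
  rw [sum_congr rfl hcomb, ← mul_sum]
  congr 1
  -- edges ↔ pairs `(z, i)`
  have hpairs := sum_pairs_eq_sum_edgeFinset (d := d) L (by omega)
    (Sym2.lift ⟨fun x y => xyGroundCorr 1 L n x y -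
      Real.cos (torusPhase L q (x - y)) * xyGroundCorr 2 L n x y, fun x y => by
        dsimp only
        rw [xyGroundCorr_symm 1 L n x y, xyGroundCorr_symm 2 L n x y, cos_torusPhase_sub,
          cos_torusPhase_sub]; ring⟩)
  rw [if_neg (by omega), one_mul] at hpairs
  rw [← hpairs, sum_comm]
  refine sum_congr rfl fun i _ => sum_congr rfl fun z _ => ?_
  simp only [Sym2.lift_mk]
  rw [sub_add_cancel_left, cos_torusPhase_neg_single]

end HamiltonianDC

/-! ### Lattice symmetries: relabelling sites is conjugation by a permutation unitary -/

section PermutationUnitary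

variable {m : Type*} [Fintype m] [DecidableEq m]

omit [Fintype m] in
/-- The adjoint of a permutation matrix is the matrix of the inverse permutation. [folklore] -/
theorem conjTranspose_toPEquiv_toMatrix (e : m ≃ m) :
    ((e.toPEquiv.toMatrix : Matrix m m ℂ))ᴴ = e.symm.toPEquiv.toMatrix := by
  ext i j
  simp only [conjTranspose_apply, PEquiv.toMatrix_apply, Equiv.toPEquiv_apply, Option.mem_def,
    Option.some.injEq, apply_ite (star : ℂ → ℂ), star_one, star_zero]
  congr 1
  rw [eq_iff_iff]
  exact ⟨fun h => by rw [← h, Equiv.symm_apply_apply], fun h => by rw [← h, Equiv.apply_symm_apply]⟩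

/-- Permutation matrices are unitary: `Pᴴ P = 1`. [folklore] -/
theorem conjTranspose_toPEquiv_toMatrix_mul_self (e : m ≃ m) :
    ((e.toPEquiv.toMatrix : Matrix m m ℂ))ᴴ * e.toPEquiv.toMatrix = 1 := by
  rw [conjTranspose_toPEquiv_toMatrix, ← PEquiv.toMatrix_trans, ← Equiv.toPEquiv_trans,
    Equiv.symm_trans_self, Equiv.toPEquiv_refl, PEquiv.toMatrix_refl]

/-- Conjugation by a permutation matrix reindexes: `P M Pᴴ = M ∘ (e × e)`. [folklore] -/
theorem toPEquiv_toMatrix_conj (e : m ≃ m) (M : Matrix m m ℂ) :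
    (e.toPEquiv.toMatrix : Matrix m m ℂ) * M * (e.toPEquiv.toMatrix : Matrix m m ℂ)ᴴ =
      M.submatrix e e := by
  rw [PEquiv.toMatrix_toPEquiv_mul, conjTranspose_toPEquiv_toMatrix, PEquiv.mul_toMatrix_toPEquiv,
    submatrix_submatrix, Equiv.symm_symm]
  rfl

/-- **Invariance of the tracial ground state under a symmetry of the index set**: if reindexing
along `e` fixes the Hermitian `H`, then `ω_H(O ∘ (e × e)) = ω_H(O)`. [folklore] -/
theorem groundStateFunctional_submatrix_of_invariant {H : Matrix m m ℂ} (hH : H.IsHermitian)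
    (e : m ≃ m) (hinv : H.submatrix e e = H) (O : Matrix m m ℂ) :
    H.groundStateFunctional (O.submatrix e e) = H.groundStateFunctional O := by
  set U : Matrix m m ℂ := e.toPEquiv.toMatrix with hU
  have hUU : Uᴴ * U = 1 := conjTranspose_toPEquiv_toMatrix_mul_self e
  have hcomm : U * H = H * U := by
    have h1 : U * H * Uᴴ = H := by rw [hU, toPEquiv_toMatrix_conj, hinv]
    calc U * H = U * H * (Uᴴ * U) := by rw [hUU, mul_one]
      _ = U * H * Uᴴ * U := by rw [← mul_assoc]
      _ = H * U := by rw [h1]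
  rw [← toPEquiv_toMatrix_conj, ← hU]
  exact groundStateFunctional_conj_of_commute hH hcomm hUU O

end PermutationUnitary

section SiteRelabelling

variable {Λ : Type*} [Fintype Λ] [DecidableEq Λ] {q : ℕ}

/-- Relabelling sites along `π` maps the operator `a` at `x` to the operator `a` at `π x`
(on tensor indices, `σ ↦ σ ∘ π`). [Bratteli–Robinson II §6.2.1 (covariance)] [folklore] -/
theorem onSite_submatrix_comp (π : Λ ≃ Λ) (x : Λ) (a : Matrix (Fin q) (Fin q) ℂ) :
    (onSite x a : Op Λ q).submatrix (fun σ => σ ∘ π) (fun σ => σ ∘ π) = onSite (π x) a := by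
  ext σ τ
  simp only [submatrix_apply, onSite_apply, Function.comp_apply]
  have hiff : (∀ y, y ≠ x → σ (π y) = τ (π y)) ↔ (∀ y, y ≠ π x → σ y = τ y) := by
    constructor
    · intro h y hy
      have := h (π.symm y) (fun h' => hy (by rw [← h', Equiv.apply_symm_apply]))
      rwa [Equiv.apply_symm_apply] at this
    · intro h y hy
      exact h (π y) (fun h' => hy (π.injective h'))
  by_cases h1 : ∀ y, y ≠ π x → σ y = τ y
  · rw [if_pos (hiff.2 h1), if_pos h1]
  · rw [if_neg (fun h => h1 (hiff.1 h)), if_neg h1]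

omit [Fintype Λ] [DecidableEq Λ] in
/-- `σ ↦ σ ∘ π` is a bijection of the tensor indices. [folklore] -/
theorem bijective_comp_equiv (π : Λ ≃ Λ) :
    Function.Bijective (fun σ : TensorIndex Λ q => σ ∘ π) :=
  (Equiv.arrowCongr π.symm (Equiv.refl (Fin q))).bijective

/-- Relabelling the spins: `S^α_x ↦ S^α_{π x}`. [folklore] -/
theorem siteSpin_submatrix_comp (n : ℕ) (π : Λ ≃ Λ) (x : Λ) (α : Fin 3) :
    (siteSpin n x α : Op Λ (n + 1)).submatrix (fun σ => σ ∘ π) (fun σ => σ ∘ π) =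
      siteSpin n (π x) α :=
  onSite_submatrix_comp π x _

/-- Relabelling the bond operators. [folklore] -/
theorem spinBond_submatrix_comp (n : ℕ) (π : Λ ≃ Λ) (x y : Λ) (α : Fin 3) :
    (spinBond n α x y : Op Λ (n + 1)).submatrix (fun σ => σ ∘ π) (fun σ => σ ∘ π) =
      spinBond n α (π x) (π y) := by
  simp only [spinBond, submatrix_smul, submatrix_add, Pi.smul_apply, Pi.add_apply,
    Matrix.submatrix_mul _ _ _ _ _ (bijective_comp_equiv (q := n + 1) π), siteSpin_submatrix_comp]

/-- Reindexing a finite sum of matrices. [folklore] -/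
theorem submatrix_finset_sum {ι m' n' l o : Type*} {α : Type*} [AddCommMonoid α] (s : Finset ι)
    (f : ι → Matrix m' n' α) (r : l → m') (c : o → n') :
    (∑ i ∈ s, f i).submatrix r c = ∑ i ∈ s, (f i).submatrix r c := by
  ext a b
  simp only [submatrix_apply, Matrix.sum_apply]

end SiteRelabelling

section CoordinatePermutation

variable (L : ℕ) [NeZero L] (n : ℕ)

omit [NeZero L] in
/-- A permutation `s` of the coordinate axes acts on the torus by `x ↦ x ∘ s`; it maps the unit
vector `eᵢ` to `e_{s⁻¹ i}`. [folklore] -/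
theorem single_comp_perm (s : Equiv.Perm (Fin d)) (i : Fin d) :
    ((Pi.single i (1 : ZMod L) : TorusSite d L) ∘ s) = Pi.single (s.symm i) 1 := by
  ext k
  simp only [Function.comp_apply, Pi.single_apply, Equiv.apply_eq_iff_eq_symm_apply]

omit [NeZero L] in
/-- `(x + eᵢ) ∘ s = x ∘ s + e_{s⁻¹ i}`. [folklore] -/
theorem add_single_comp_perm (s : Equiv.Perm (Fin d)) (x : TorusSite d L) (i : Fin d) :
    ((x + Pi.single i 1) ∘ s : TorusSite d L) = x ∘ s + Pi.single (s.symm i) 1 := by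
  rw [← single_comp_perm L s i]
  rfl

omit [NeZero L] in
/-- `x ↦ x ∘ s` is injective on the torus. [folklore] -/
theorem comp_perm_inj (s : Equiv.Perm (Fin d)) {x y : TorusSite d L} :
    (x ∘ s : TorusSite d L) = y ∘ s ↔ x = y :=
  ⟨fun h => by
    ext k
    simpa using congrFun h (s.symm k), fun h => by rw [h]⟩

omit [NeZero L] in
/-- Precomposition with a permutation of the axes is a graph automorphism of the torus.
[folklore] -/
theorem torusGraph_adj_comp_perm (s : Equiv.Perm (Fin d)) (x y : TorusSite d L) :
    (torusGraph d L).Adj (x ∘ s) (y ∘ s) ↔ (torusGraph d L).Adj x y := by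
  have key : ∀ x y : TorusSite d L,
      (∃ i, (y ∘ s : TorusSite d L) = x ∘ s + Pi.single i 1) ↔ ∃ i, y = x + Pi.single i 1 := by
    intro x y
    constructor
    · rintro ⟨i, hi⟩
      refine ⟨s i, (comp_perm_inj L s).1 ?_⟩
      rw [add_single_comp_perm, Equiv.symm_apply_apply]
      exact hi
    · rintro ⟨i, rfl⟩
      exact ⟨s.symm i, add_single_comp_perm L s x i⟩
  rw [torusGraph_adj_iff, torusGraph_adj_iff, ne_eq, ne_eq, comp_perm_inj]
  exact and_congr_right fun _ => or_congr (key x y) (key y x)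

/-- The edge set of the torus graph is invariant under permutations of the axes. [folklore] -/
theorem map_comp_perm_mem_edgeFinset (s : Equiv.Perm (Fin d)) (e : Sym2 (TorusSite d L)) :
    Sym2.map (fun x : TorusSite d L => (x ∘ s : TorusSite d L)) e ∈ (torusGraph d L).edgeFinset ↔
      e ∈ (torusGraph d L).edgeFinset := by
  induction e using Sym2.ind with
  | h x y =>
    rw [Sym2.map_mk, SimpleGraph.mem_edgeFinset, SimpleGraph.mem_edgeSet,
      SimpleGraph.mem_edgeFinset, SimpleGraph.mem_edgeSet, torusGraph_adj_comp_perm]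

omit [NeZero L] in
/-- The site relabelling `x ↦ x ∘ s` as a permutation of the torus. [folklore] -/
theorem arrowCongr_symm_apply (s : Equiv.Perm (Fin d)) (x : TorusSite d L) :
    (Equiv.arrowCongr s.symm (Equiv.refl (ZMod L))) x = x ∘ s := rfl

/-- **The XY Hamiltonian of the torus is invariant under permutations of the coordinate axes**
(relabelling of sites `x ↦ x ∘ s`, acting on tensor indices by `σ ↦ σ ∘ π`). [folklore] -/
theorem xyTorus_submatrix_comp_perm (s : Equiv.Perm (Fin d)) :
    (xyTorus d L n).submatrix
        (fun σ : TensorIndex (TorusSite d L) (n + 1) =>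
          σ ∘ (Equiv.arrowCongr s.symm (Equiv.refl (ZMod L))))
        (fun σ => σ ∘ (Equiv.arrowCongr s.symm (Equiv.refl (ZMod L)))) =
      xyTorus d L n := by
  set π : TorusSite d L ≃ TorusSite d L := Equiv.arrowCongr s.symm (Equiv.refl (ZMod L)) with hπ
  rw [xyTorus_eq_bondSum, submatrix_finset_sum]
  -- reindex the edge sum along the graph automorphism `Sym2.map π`
  refine Finset.sum_nbij' (Sym2.map π) (Sym2.map π.symm) (fun e he => ?_) (fun e he => ?_)
    (fun e _ => ?_) (fun e _ => ?_) (fun e _ => ?_)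
  · exact (map_comp_perm_mem_edgeFinset L s e).2 he
  · exact (map_comp_perm_mem_edgeFinset L s.symm e).2 he
  · simp only [Sym2.map_map, Equiv.symm_comp_self, Sym2.map_id', id_eq]
  · simp only [Sym2.map_map, Equiv.self_comp_symm, Sym2.map_id', id_eq]
  · induction e using Sym2.ind with
    | h x y =>
      simp only [Sym2.map_mk, Sym2.lift_mk, submatrix_add, submatrix_smul, Pi.add_apply,
        Pi.smul_apply, spinBond_submatrix_comp]

/-- Invariance of the tracial ground state of `H = xyTorus` under a site relabelling `π` fixing
`H`: `ω(O ∘ (π × π)) = ω(O)` (on tensor indices, `σ ↦ σ ∘ π`). [folklore] -/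
theorem groundStateFunctional_submatrix_comp {Λ : Type*} [Fintype Λ] [DecidableEq Λ] {q : ℕ}
    {H : Op Λ q} (hH : H.IsHermitian) (π : Λ ≃ Λ)
    (hinv : H.submatrix (fun σ => σ ∘ π) (fun σ => σ ∘ π) = H) (O : Op Λ q) :
    H.groundStateFunctional (O.submatrix (fun σ => σ ∘ π) (fun σ => σ ∘ π)) =
      H.groundStateFunctional O :=
  groundStateFunctional_submatrix_of_invariant hH (Equiv.arrowCongr π.symm (Equiv.refl (Fin q)))
    hinv O

/-- The two-point function is invariant under permutations of the coordinate axes: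
`G^α(x ∘ s, y ∘ s) = G^α(x, y)`. [folklore] -/
theorem xyGroundCorr_comp_perm (s : Equiv.Perm (Fin d)) (α : Fin 3) (x y : TorusSite d L) :
    xyGroundCorr α L n (x ∘ s) (y ∘ s) = xyGroundCorr α L n x y := by
  rw [xyGroundCorr_of_neZero, xyGroundCorr_of_neZero, ← arrowCongr_symm_apply L s x,
    ← arrowCongr_symm_apply L s y, ← siteSpin_submatrix_comp n _ x α,
    ← siteSpin_submatrix_comp n _ y α,
    ← Matrix.submatrix_mul _ _ _ _ _ (bijective_comp_equiv (q := n + 1) _),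
    groundStateFunctional_submatrix_comp (xyTorus_isHermitian d L n) _
      (xyTorus_submatrix_comp_perm L n s)]

/-- **Direction independence of the nearest-neighbour correlations** (fact (SYM)):
`Σ_z G^α(z, z + eᵢ) = Σ_z G^α(z, z + eⱼ)` — the transposition of the axes `i`, `j` is a symmetry of
the torus and of `H`, and the tracial ground state is invariant under symmetries. This is the
statement "`⟨S_0 S_{δᵢ}⟩` is independent of `i`" used in Kennedy–Lieb–Shastry 1988, eq. (3).
[cite: KLS1988PRL, eq. (3)] [folklore] -/
theorem sum_xyGroundCorr_dir_eq (α : Fin 3) (i j : Fin d) :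
    ∑ z : TorusSite d L, xyGroundCorr α L n z (z + Pi.single i 1) =
      ∑ z : TorusSite d L, xyGroundCorr α L n z (z + Pi.single j 1) := by
  have hsi : (Equiv.swap i j).symm i = j := by rw [Equiv.symm_swap, Equiv.swap_apply_left]
  calc ∑ z : TorusSite d L, xyGroundCorr α L n z (z + Pi.single i 1)
      = ∑ z : TorusSite d L, xyGroundCorr α L n (z ∘ Equiv.swap i j)
          ((z ∘ Equiv.swap i j : TorusSite d L) + Pi.single j 1) :=
        sum_congr rfl fun z _ => by
          rw [← xyGroundCorr_comp_perm L n (Equiv.swap i j) α z, add_single_comp_perm, hsi]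
    _ = ∑ z : TorusSite d L, xyGroundCorr α L n z (z + Pi.single j 1) :=
        (Equiv.arrowCongr (Equiv.swap i j).symm (Equiv.refl (ZMod L))).sum_comp
          (fun z => xyGroundCorr α L n z (z + Pi.single j 1))

/-- (SYM) for the bond average: `Σ_z G^α(z, z+eᵢ) = L^d e_α` for every direction `i`
(`e_α = xyBondCorr α`, the average over sites and directions). [cite: KLS1988PRL, eq. (3)]
[folklore] -/
theorem sum_xyGroundCorr_dir_eq_bondCorr (hd : 0 < d) (α : Fin 3) (i : Fin d) :
    ∑ z : TorusSite d L, xyGroundCorr α L n z (z + Pi.single i 1) =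
      xyBondCorr (d := d) α L n * (L : ℝ) ^ d := by
  have hL : (0 : ℝ) < (L : ℝ) ^ d := by
    have : (0 : ℝ) < L := by exact_mod_cast Nat.pos_of_ne_zero (NeZero.ne L)
    positivity
  have hd' : (0 : ℝ) < d := by exact_mod_cast hd
  rw [xyBondCorr_of_neZero, sum_comm,
    sum_congr rfl fun j _ => sum_xyGroundCorr_dir_eq L n α j i, sum_const, card_univ,
    Fintype.card_fin, nsmul_eq_mul]
  field_simp

end CoordinatePermutation

/-! ### Assembly: Gaussian domination ⇒ the infrared bound (A) ⇒ long-range order -/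

section InfraredAssembly

variable (L : ℕ) [NeZero L] (n : ℕ)

/-- `Re ω(C²) ≥ 0` for Hermitian `C` (positivity of the tracial ground state). [folklore] -/
theorem re_groundStateFunctional_mul_self_nonneg {m : Type*} [Fintype m] [DecidableEq m]
    (A : Matrix m m ℂ) {C : Matrix m m ℂ} (hC : C.IsHermitian) :
    0 ≤ (A.groundStateFunctional (C * C)).re := by
  have h := groundStateFunctional_nonneg A C
  rw [hC.eq] at h
  exact (Complex.nonneg_iff.mp h).1

/-- `Re ω(C K C) ≥ 0` for Hermitian `C` and `K ≥ 0`. [folklore] -/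
theorem re_groundStateFunctional_conj_nonneg {m : Type*} [Fintype m] [DecidableEq m]
    (A : Matrix m m ℂ) {C K : Matrix m m ℂ} (hC : C.IsHermitian) (hK : K.PosSemidef) :
    0 ≤ (A.groundStateFunctional (C * K * C)).re := by
  have hpsd : (C * K * C).PosSemidef := by
    simpa only [hC.eq] using hK.conjTranspose_mul_mul_same C
  exact (Complex.nonneg_iff.mp (groundStateFunctional_nonneg_of_posSemidef A hpsd)).1

/-- **One mode.** If `E₀(H) ≤ E₀(H(h))` for all fields and the field term of `h` is `V_h = r W`
with `r ≠ 0` and `W` Hermitian, then for all real `μ`,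
`0 ≤ ½ r⁻² Q(h) + 2μ Re ω(W²) + μ² Re ω(W (H - E₀) W)` (apply (GD) to the fields `t r⁻¹ h` and
`Matrix.groundState_infraredBound_quadratic`). [Kennedy–Lieb–Shastry, J. Stat. Phys. 53 (1988),
eqs. (18)–(19)] [cite: KLS1988JSP, eqs. (18)–(19)] -/
theorem xy_modeQuadratic_nonneg
    (hGD : ∀ h : TorusSite d L → ℝ,
      (xyTorus d L n).groundEnergy ≤ (xyFieldHamiltonian L n h).groundEnergy)
    {h : TorusSite d L → ℝ} {W : Op (TorusSite d L) (n + 1)} (hW : W.IsHermitian) {r : ℝ}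
    (hVh : xyGradField L n h = (r : ℂ) • W) (hr : r ≠ 0) (μ : ℝ) :
    0 ≤ r⁻¹ ^ 2 * xyFieldEnergy L h / 2 +
      2 * μ * ((xyTorus d L n).groundStateFunctional (W * W)).re +
      μ ^ 2 * ((xyTorus d L n).groundStateFunctional
        (W * (xyTorus d L n - ((xyTorus d L n).groundEnergy : ℂ) • 1) * W)).re := by
  have hV : xyGradField L n (r⁻¹ • h) = W := by
    rw [xyGradField_smul, hVh, smul_smul, ← Complex.ofReal_mul, inv_mul_cancel₀ hr,
      Complex.ofReal_one, one_smul]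
  have hQ : xyFieldEnergy L (r⁻¹ • h) = r⁻¹ ^ 2 * xyFieldEnergy L h := xyFieldEnergy_smul L r⁻¹ h
  have key := Matrix.groundState_infraredBound_quadratic (xyTorus_isHermitian d L n) hW.neg
    (Q := r⁻¹ ^ 2 * xyFieldEnergy L h) (fun t => by
      have ht := hGD (t • (r⁻¹ • h))
      rwa [xyFieldHamiltonian_smul, hV, hQ] at ht) μ
  simpa only [neg_mul, mul_neg, neg_neg] using key

/-- `Re ω(W (H - E₀) W) = ½ Re ω([W, [H, W]])`. [Kennedy–Lieb–Shastry, J. Stat. Phys. 53 (1988),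
eqs. (12)–(13)] [folklore] -/
theorem re_groundStateFunctional_conj_eq_lie_lie (W : Op (TorusSite d L) (n + 1)) :
    ((xyTorus d L n).groundStateFunctional
        (W * (xyTorus d L n - ((xyTorus d L n).groundEnergy : ℂ) • 1) * W)).re =
      ((xyTorus d L n).groundStateFunctional ⁅W, ⁅xyTorus d L n, W⁆⁆).re / 2 := by
  rw [Matrix.groundStateFunctional_mul_sub_groundEnergy_mul (xyTorus_isHermitian d L n) W,
    show (⁅W, ⁅xyTorus d L n, W⁆⁆ : Op (TorusSite d L) (n + 1)) =
      W * (xyTorus d L n * W) - W * (W * xyTorus d L n) -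
        (xyTorus d L n * W * W - W * (xyTorus d L n * W)) by
      simp only [Ring.lie_def, mul_sub, sub_mul, mul_assoc]]
  simp only [Complex.mul_re, one_div, Complex.inv_re, Complex.inv_im]
  norm_num
  ring

/-- **(GD) ⇒ (A) in finite volume.** For side `L ≥ 3`, `d ≥ 1`, every spin, and every momentum
`q ≠ 0` of the dual torus: if `E₀(H) ≤ E₀(H(h))` for all real fields `h`, then
`0 ≤ ĝ¹_q` and `(ĝ¹_q)² E_q ≤ ¼ Σᵢ (e₁ - e₃ cos qᵢ)`.
The two modes `C_q, D_q` (fields `cos(q·)/2E_q`, `sin(q·)/2E_q`) give two quadratic inequalities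
(`xy_modeQuadratic_nonneg`) whose sum has nonpositive discriminant:
`(ω(C²) + ω(D²))² ≤ (|(L : ℝ) ^ d|/4E_q) · ½(ω([C,[H,C]]) + ω([D,[H,D]]))`; the left side is `(|(L : ℝ) ^ d| ĝ¹_q)²`
(`xyStructureFactor_eq_modes`), the double commutator is `|(L : ℝ) ^ d| Σᵢ (e₂ - e₃ cos qᵢ)`
(`re_groundStateFunctional_lie_lie_modes`, (SYM)), and `e₂ = e₁` ((S)).
[Kennedy–Lieb–Shastry 1988, eq. (4); KLS J. Stat. Phys. 53 (1988), eqs. (12)–(14), (18)–(19)]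
[cite: KLS1988PRL, eq. (4)] [cite: KLS1988JSP, eqs. (12)–(14)] -/
theorem xy_infraredBound_of_groundEnergy_le (hL : 3 ≤ L) (hd : 0 < d)
    (hGD : ∀ h : TorusSite d L → ℝ,
      (xyTorus d L n).groundEnergy ≤ (xyFieldHamiltonian L n h).groundEnergy)
    (hS : xy_groundCorr_two_eq_one) (q : TorusSite d L) (hq : q ≠ 0) :
    0 ≤ xyStructureFactor 0 L n q ∧
      xyStructureFactor 0 L n q ^ 2 * dispersion (latticeMomentum L q) ≤
        (1 / 4 : ℝ) * ∑ i, (xyBondCorr (d := d) 0 L n -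
          xyBondCorr (d := d) 2 L n * Real.cos (latticeMomentum L q i)) := by
  -- notation
  set H : Op (TorusSite d L) (n + 1) := xyTorus d L n with hH_def
  have hH : H.IsHermitian := xyTorus_isHermitian d L n
  set E : ℝ := dispersion (latticeMomentum L q) with hE_def
  have hE : 0 < E := dispersion_latticeMomentum_pos hq
  set C : Op (TorusSite d L) (n + 1) := xyCosMode L n q with hC_def
  set D : Op (TorusSite d L) (n + 1) := xySinMode L n q with hD_def
  set K : Op (TorusSite d L) (n + 1) := H - (H.groundEnergy : ℂ) • 1 with hK_def
  set aC : ℝ := (H.groundStateFunctional (C * C)).re with haC_def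
  set aD : ℝ := (H.groundStateFunctional (D * D)).re with haD_def
  set bC : ℝ := (H.groundStateFunctional (C * K * C)).re with hbC_def
  set bD : ℝ := (H.groundStateFunctional (D * K * D)).re with hbD_def
  set Qc : ℝ := xyFieldEnergy L (fun x => Real.cos (torusPhase L q x)) with hQc_def
  set Qs : ℝ := xyFieldEnergy L (fun x => Real.sin (torusPhase L q x)) with hQs_def
  have hLd : 0 < (L : ℝ) ^ d := by
    have : (0 : ℝ) < L := by exact_mod_cast Nat.pos_of_ne_zero (NeZero.ne L)
    positivity
  set Sg : ℝ := ∑ i, (xyBondCorr (d := d) 0 L n -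
    xyBondCorr (d := d) 2 L n * Real.cos (latticeMomentum L q i)) with hSg_def
  have h2E : (2 * E) ≠ 0 := by positivity
  -- the two quadratic inequalities
  have hquadC : ∀ μ : ℝ, 0 ≤ (2 * E)⁻¹ ^ 2 * Qc / 2 + 2 * μ * aC + μ ^ 2 * bC := fun μ =>
    xy_modeQuadratic_nonneg L n hGD (xyCosMode_isHermitian L n q) (xyGradField_cos L n q) h2E μ
  have hquadS : ∀ μ : ℝ, 0 ≤ (2 * E)⁻¹ ^ 2 * Qs / 2 + 2 * μ * aD + μ ^ 2 * bD := fun μ =>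
    xy_modeQuadratic_nonneg L n hGD (xySinMode_isHermitian L n q) (xyGradField_sin L n q) h2E μ
  -- their sum and its discriminant
  have hQsum : (2 * E)⁻¹ ^ 2 * Qc / 2 + (2 * E)⁻¹ ^ 2 * Qs / 2 = (L : ℝ) ^ d / (4 * E) := by
    have h := xyFieldEnergy_cos_add_sin L q
    rw [← hQc_def, ← hQs_def, ← hE_def] at h
    rw [show (2 * E)⁻¹ ^ 2 * Qc / 2 + (2 * E)⁻¹ ^ 2 * Qs / 2 = (2 * E)⁻¹ ^ 2 * (Qc + Qs) / 2 by
      ring, h]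
    field_simp
    ring
  have hdisc : (aC + aD) ^ 2 ≤ (bC + bD) * ((L : ℝ) ^ d / (4 * E)) := by
    have hq' : ∀ x : ℝ, 0 ≤ (bC + bD) * (x * x) + 2 * (aC + aD) * x + (L : ℝ) ^ d / (4 * E) := by
      intro x
      have h1 := hquadC x
      have h2 := hquadS x
      rw [← hQsum]
      linarith [h1, h2]
    have hd' := discrim_le_zero hq'
    rw [discrim] at hd'
    nlinarith [hd']
  -- `A = |Λ| ĝ`
  have hA : xyStructureFactor 0 L n q * (L : ℝ) ^ d = aC + aD := xyStructureFactor_eq_modes L n q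
  -- `B = |Λ| Σᵢ (e₁ - e₃ cos qᵢ)`
  have hB : bC + bD = (L : ℝ) ^ d * Sg := by
    rw [hbC_def, hbD_def, re_groundStateFunctional_conj_eq_lie_lie L n C,
      re_groundStateFunctional_conj_eq_lie_lie L n D, ← add_div,
      re_groundStateFunctional_lie_lie_modes L n hL q, mul_div_cancel_left₀ _ two_ne_zero, hSg_def,
      mul_sum]
    refine sum_congr rfl fun i _ => ?_
    simp only [hS d L n]
    rw [sum_sub_distrib, ← mul_sum, sum_xyGroundCorr_dir_eq_bondCorr L n hd 0 i,
      sum_xyGroundCorr_dir_eq_bondCorr L n hd 2 i]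
    ring
  -- positivity of `A`
  have haC : 0 ≤ aC := re_groundStateFunctional_mul_self_nonneg H (xyCosMode_isHermitian L n q)
  have haD : 0 ≤ aD := re_groundStateFunctional_mul_self_nonneg H (xySinMode_isHermitian L n q)
  have hg0 : 0 ≤ xyStructureFactor 0 L n q := by
    have h0 : 0 ≤ xyStructureFactor 0 L n q * (L : ℝ) ^ d := by rw [hA]; exact add_nonneg haC haD
    exact nonneg_of_mul_nonneg_left h0 hLd
  refine ⟨hg0, ?_⟩
  -- `(|Λ| ĝ)² ≤ |Λ| Σ · |Λ|/(4E)` ⇒ `ĝ² E ≤ Σ/4`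
  rw [hB, ← hA] at hdisc
  have h1 : xyStructureFactor 0 L n q ^ 2 * (4 * E) * ((L : ℝ) ^ d) ^ 2 ≤ Sg * ((L : ℝ) ^ d) ^ 2 := by
    have h4E : 0 < 4 * E := by positivity
    have := mul_le_mul_of_nonneg_right hdisc h4E.le
    calc xyStructureFactor 0 L n q ^ 2 * (4 * E) * ((L : ℝ) ^ d) ^ 2
        = (xyStructureFactor 0 L n q * (L : ℝ) ^ d) ^ 2 * (4 * E) := by ring
      _ ≤ (L : ℝ) ^ d * Sg * ((L : ℝ) ^ d / (4 * E)) * (4 * E) := this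
      _ = Sg * ((L : ℝ) ^ d) ^ 2 := by field_simp
  have h2 : xyStructureFactor 0 L n q ^ 2 * (4 * E) ≤ Sg :=
    le_of_mul_le_mul_right h1 (by positivity)
  linarith [h2]

/-- **(GD) ⇒ (A).** Ground-state Gaussian domination implies the Kennedy–Lieb–Shastry infrared
bound (A) `kls_xy_infraredBound_ground` for all `d ≥ 2`, all spins, all even sides `L ≥ 4` and all
`q ≠ 0`. [Kennedy–Lieb–Shastry 1988, eq. (4) and the remark following it; KLS J. Stat. Phys. 53
(1988), eqs. (12)–(14), (18)–(19)] [cite: KLS1988PRL, eq. (4)] [cite: KLS1988JSP, eqs. (12)–(19)] -/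
theorem kls_xy_infraredBound_ground_of_gaussianDomination
    (hGD : kls_xy_gaussianDomination_ground) : kls_xy_infraredBound_ground := by
  intro d hd n _hn k hk q hq
  haveI : NeZero (2 * k) := ⟨by omega⟩
  exact xy_infraredBound_of_groundEnergy_le (2 * k) n (by omega) (by omega)
    (fun h => hGD d n (2 * k) (even_two_mul k) (by omega) h) xy_groundCorr_two_eq_one_holds q hq

/-- **(GD) ⇒ the Kennedy–Lieb–Shastry theorem.** With (B), (C), (D), (S), (T)
(`XYOrderDischarges`), (E) and (R'') (`XYOrderIntegralProofs`) proved, ground-state Gaussian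
domination is the only remaining input of `kennedy_lieb_shastry_xy_ground`.
[Kennedy–Lieb–Shastry 1988, Theorem] [cite: KLS1988PRL, Theorem] -/
theorem kennedy_lieb_shastry_xy_ground_of_gaussianDomination
    (hGD : kls_xy_gaussianDomination_ground) : kennedy_lieb_shastry_xy_ground :=
  kennedy_lieb_shastry_xy_ground_of_riemannSum_le
    (kls_xy_infraredBound_ground_of_gaussianDomination hGD) kubo_xy_bondCorr_abs_le_holds
    xy_structureFactor_sumRule_holds kls_xy_bondCorr_lower_holds xy_groundCorr_two_eq_one_holds
    xyGroundCorr_abs_le_holds klsRiemannSum_eventually_le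

end InfraredAssembly

end Literature.MathematicalPhysics.QuantumLattice
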